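import Mathlib
import Literature.Barriers.ValiantsHypothesis.AlgebraicNaturalProofs
import Literature.Computability.AlgebraicComplexity.ArithCircuitProofs
import Summits.ValiantsHypothesis.ValiantsHypothesis.Theorems.BarrierLeverSuccinctHittingSetsForVPLowDegree
import HarnessLib

/-!
# Crux `BarrierLever.SuccinctHittingSetsForVP` (stmt-ValiantsHypothesis-14610), line `registered` —
DISTINGUISHERS WITH ONE LOW-SUPPORT MONOMIAL ARE HIT (every monomial of an equation is wide)

**What is proved (unconditional; structure of the open stub `stub_levelOne`, it does NOT close the
item).** Sharpening the companion file `…LowDegree.lean` (which used the total degree): what makes a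
polynomial `D` in the `C(2n,n)` coefficient variables easy to hit by small circuits is a single
monomial of SMALL SUPPORT, whatever the degree and size of `D`.

* `LowSupport.exists_eval_ne_zero_supported` : a polynomial over `ℂ` with a monomial `m₀` in its
  support is nonzero at some point supported inside `supp m₀`;
* `isSuccinctHittingSet_of_small_support` : if `t (2n + 2) ≤ n ^ b`, the coefficient vectors of
  `SmallCircuits ℂ n b` hit every `D` having SOME monomial with `≤ t` distinct variables;
* `stub_levelOne_lowSupport` (registered stub) : level one of FSV Question 6 HOLDS against the
  level-one distinguishers with a monomial of support `≤ n ^ c` (`b = c + 2`, `n₀ = 3`);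
* `card_support_gt_of_vanishes` : dually, for `n ≥ 3`, `b ≥ 2`, EVERY monomial of an equation of
  `SmallCircuits ℂ n b` involves more than `n ^ (b - 2)` distinct coefficient variables — equations
  for `VP` are "wide" in every term (as CKRST's finite-field equations, products over large sets of
  coefficients, indeed are).

Proof: as in `…LowDegree.lean` — kill the variables outside `S = supp m₀` (the coefficient of `m₀`
survives, `LowDegree.coeff_subst_self`), take a non-root of the nonzero restriction
(`MvPolynomial.funext`), and realise the resulting `|S|`-sparse vector as the coefficient vector of
an `|S|`-sparse polynomial of degree `≤ n` and size `≤ |S| (2n+2)` (`LowDegree.sparse_mem_smallCircuits`).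
Axioms: `propext`, `Classical.choice`, `Quot.sound`. References: [ForbesShpilkaVolk2018] Def. 1,
Def. 3, Question 6 (framework); the argument is folklore.
-/

-- layout Summits/ValiantsHypothesis/ValiantsHypothesis forces the duplicated namespace component
set_option linter.dupNamespace false

namespace Summit.ValiantsHypothesis.ValiantsHypothesis.Theorems.BarrierLever.SuccinctHittingSetsForVP

open Literature.Barriers.ValiantsHypothesis Literature.Computability.AlgebraicComplexity MvPolynomial

namespace LowSupport

variable {ι : Type*} [DecidableEq ι]

/-- **Supported non-roots.** If `m₀` is a monomial of `D` (over `ℂ`, any set of variables), then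
`D(w) ≠ 0` for some point `w` vanishing outside `supp m₀`. [folklore] -/
theorem exists_eval_ne_zero_supported {D : MvPolynomial ι ℂ} {m₀ : ι →₀ ℕ} (hm₀ : m₀ ∈ D.support) :
    ∃ w : ι → ℂ, (∀ i, i ∉ m₀.support → w i = 0) ∧ eval w D ≠ 0 := by
  classical
  have hc : coeff m₀ D ≠ 0 := mem_support_iff.mp hm₀
  have hne : aeval (fun i => if i ∈ m₀.support then (X i : MvPolynomial ι ℂ) else 0) D ≠ 0 := by
    intro h0
    have := LowDegree.coeff_subst_self m₀.support D (subset_refl _)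
    rw [h0, coeff_zero] at this
    exact hc this.symm
  obtain ⟨w', hw'⟩ :
      ∃ w', eval w' (aeval (fun i => if i ∈ m₀.support then (X i : MvPolynomial ι ℂ) else 0) D) ≠ 0 := by
    by_contra hcon
    push Not at hcon
    exact hne (MvPolynomial.funext fun v => by simpa using hcon v)
  refine ⟨fun i => if i ∈ m₀.support then w' i else 0, fun i hi => if_neg hi, ?_⟩
  rwa [LowDegree.eval_subst] at hw'

end LowSupport

open LowSupport

/-- **Distinguishers with one low-support monomial are hit, whatever their degree and size.** If
`t (2n + 2) ≤ n ^ b`, the coefficient vectors of `SmallCircuits ℂ n b` hit every polynomial `D` in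
the coefficient variables having some monomial with at most `t` distinct variables.
[cite: ForbesShpilkaVolk2018, Def. 3 and Question 6] -/
theorem isSuccinctHittingSet_of_small_support {n t b : ℕ} (h : t * (2 * n + 2) ≤ n ^ b) :
    IsSuccinctHittingSet (degLEMonomials n) (SmallCircuits ℂ n b)
      {D : MvPolynomial (degLEMonomials n) ℂ | ∃ m ∈ D.support, m.support.card ≤ t} := by
  classical
  rintro D ⟨m₀, hm₀, hcard⟩ -
  obtain ⟨w, hw, hne⟩ := exists_eval_ne_zero_supported hm₀
  refine ⟨∑ μ ∈ m₀.support, monomial (μ : Fin n →₀ ℕ) (w μ),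
    LowDegree.sparse_mem_smallCircuits m₀.support w ?_, ?_⟩
  · exact le_trans (Nat.mul_le_mul_right _ hcard) h
  · rwa [LowDegree.coeffVector_sparse m₀.support hw]

/-- **Polynomial form**: for `n ≥ 3`, `SmallCircuits ℂ n (c + 2)` hits every polynomial with a
monomial of support `≤ n ^ c`. [cite: ForbesShpilkaVolk2018, Question 6] -/
theorem isSuccinctHittingSet_of_small_support_pow {n : ℕ} (c : ℕ) (hn : 3 ≤ n) :
    IsSuccinctHittingSet (degLEMonomials n) (SmallCircuits ℂ n (c + 2))
      {D : MvPolynomial (degLEMonomials n) ℂ | ∃ m ∈ D.support, m.support.card ≤ n ^ c} := by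
  refine isSuccinctHittingSet_of_small_support ?_
  calc n ^ c * (2 * n + 2) ≤ n ^ c * (n * n) := Nat.mul_le_mul_left _ (by nlinarith)
    _ = n ^ (c + 2) := by ring

/-- **Every monomial of an equation is wide.** For `n ≥ 3`, `b ≥ 2`: if `D` vanishes at the
coefficient vector of every `f ∈ SmallCircuits ℂ n b`, then every monomial of `D` involves more
than `n ^ (b - 2)` distinct coefficient variables. [cite: ForbesShpilkaVolk2018, Def. 1] -/
theorem card_support_gt_of_vanishes {n b : ℕ} (hn : 3 ≤ n) (hb : 2 ≤ b)
    {D : MvPolynomial (degLEMonomials n) ℂ}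
    (hvan : ∀ f ∈ SmallCircuits ℂ n b, eval (coeffVector (degLEMonomials n) f) D = 0)
    {m : (degLEMonomials n) →₀ ℕ} (hm : m ∈ D.support) : n ^ (b - 2) < m.support.card := by
  by_contra hle
  push Not at hle
  have hb2 : b - 2 + 2 = b := by omega
  have hD0 : D ≠ 0 := fun h0 => by simp [h0] at hm
  obtain ⟨f, hf, hne⟩ :=
    isSuccinctHittingSet_of_small_support_pow (b - 2) hn D ⟨m, hm, hle⟩ hD0
  rw [hb2] at hf
  exact hne (hvan f hf)

/-- **Registered stub `stub_levelOne_lowSupport`** (crux stmt-ValiantsHypothesis-14610, line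
`registered`; a settled part of the open stub `stub_levelOne`, sharpening `stub_levelOne_lowDegree`):
level one of FSV Question 6 holds against the level-one distinguishers possessing a monomial with
`≤ n ^ c` distinct variables (`b = c + 2`, `n₀ = 3`). [cite: ForbesShpilkaVolk2018, Question 6] -/
theorem stub_levelOne_lowSupport :
    ∀ c : ℕ, ∃ b n₀ : ℕ, ∀ n : ℕ, n₀ ≤ n →
      IsSuccinctHittingSet (degLEMonomials n) (SmallCircuits ℂ n b)
        (Distinguishers ℂ n 1 ∩ {D | ∃ m ∈ D.support, m.support.card ≤ n ^ c}) :=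
  fun c => ⟨c + 2, 3, fun _ hn =>
    (isSuccinctHittingSet_of_small_support_pow c hn).mono le_rfl Set.inter_subset_right⟩

end Summit.ValiantsHypothesis.ValiantsHypothesis.Theorems.BarrierLever.SuccinctHittingSetsForVP
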